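import Literature.Topology.FourManifolds.TubeRadial
import Literature.Topology.FourManifolds.TubeConeify
import Literature.Topology.FourManifolds.TubeRound
import HarnessLib

/-!
# Pointwise exports of the tube zones, II: crude size bounds (E4–E6)

Topic `Literature/Topology/FourManifolds`; complements `TubeExportsRadial/Cone/Round.lean`
(downward sweep of the smoothing of PD homeomorphisms; Munkres, Ann. of Math. 72 (1960), §5;
Campbell–D'Onofrio–Vítek (2026), §4).  Besides the fine exports (E1) tangential derivative, (E2)
fibre lower bound, (E3) Euler defect, a face reading a coface's zone through affine transitions
(`ExportAlgebraAffine`, `TubeCofaceReading`) needs three crude bounds of the fibre map `φ` of the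
zone: (E4) `‖D_y φ‖ ≤ X₄`, (E5) `‖φ‖ ≥ c₅ ‖y‖`, (E6) `‖φ‖ ≤ C₆ ‖y‖`.  We prove them for the three
inner zones:

* radial family zone `radialFamilyMap ρ Ψ λ` (unit family): `‖φ‖ = ρ ‖y‖` (tree:
  `norm_radialFamilyMap`) and `‖D_yφ w‖ ≤ ρ (ℓ S + K + 1) ‖w‖` from the angular bound
  `‖y‖ ‖D_pΨ (0, (0, w))‖ ≤ K ‖w‖`, the family-speed bound `‖∂_sΨ‖ ≤ S` and the slowness
  `‖y‖ |λ'| ≤ ℓ` (`norm_fderiv_radialFamilyMap_inr_le`);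
* cone zone `coneifyMap N μ`: `‖φ‖ = (‖y‖/μ) ‖N q‖` (`norm_coneifyMap`), and
  `‖D_yφ w‖ ≤ (X₄ + K₀ d/μ) ‖w‖` (`norm_fderiv_coneifyMap_inr_le`);
* rounding zone `roundMap N r₁ ρ η`: `ρ ‖y‖ ≤ ‖φ‖ ≤ ‖V‖ ‖y‖` (`norm_roundMap_ge/_le`) and
  `‖D_yφ w‖ ≤ (3 ‖V‖ + C_η ‖V‖ + 6 X₄) ‖w‖` (`norm_fderiv_roundMap_inr_le`).

All proved from the tree's derivative formulas; no definitions, no named facts.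

## References

* J. R. Munkres, *Obstructions to the smoothing of piecewise-differentiable homeomorphisms*, Ann.
  of Math. (2) 72 (1960), 521–554, §5. [Munkres1960]
* D. Campbell, L. D'Onofrio, T. Vítek, *Diffeomorphic approximation of piecewise affine
  homeomorphisms*, J. Geom. Anal. 36 (2026), §4. [CampbellDonofrioVitek2026]
-/

noncomputable section

open Set Function Metric Filter
open scoped Topology ContDiff RealInnerProductSpace

namespace Literature.Topology.FourManifolds

variable {E : Type*} [NormedAddCommGroup E] [NormedSpace ℝ E]
variable {F : Type*} [NormedAddCommGroup F] [InnerProductSpace ℝ F]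

/-- `|⟪‖y‖⁻¹ • y, w⟫| ≤ ‖w‖`. [folklore] -/
theorem abs_inner_unit_le {y : F} (w : F) : |⟪‖y‖⁻¹ • y, w⟫| ≤ ‖w‖ := by
  by_cases hy : y = 0
  · simp [hy]
  · have h := abs_real_inner_le_norm (‖y‖⁻¹ • y) w
    rwa [norm_smul, norm_inv, norm_norm, inv_mul_cancel₀ (norm_ne_zero_iff.2 hy), one_mul] at h

/-! ### Radial family zone -/

section Radial

variable {ρ : ℝ} {Ψ : ℝ → E × F → F} {lam : ℝ → ℝ} {p : E × F}

/-- **(E4, radial family zone)** `‖D_yφ w‖ ≤ ρ (ℓ S + K + 1) ‖w‖` for the unit family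
`φ = radialFamilyMap ρ Ψ λ`, given the family-speed bound `‖L (1, 0)‖ ≤ S`, the angular bound
`‖y‖ ‖L (0, (0, w))‖ ≤ K ‖w‖` (`L = D(uncurry Ψ)` at `(λ ‖y‖, p)`) and the slowness `‖y‖ |λ'| ≤ ℓ`.
[folklore] -/
theorem norm_fderiv_radialFamilyMap_inr_le (hp : p.2 ≠ 0) (hρ : 0 ≤ ρ)
    (hΨ : DifferentiableAt ℝ (uncurry Ψ) (lam ‖p.2‖, p)) {lam' : ℝ} (hlam : HasDerivAt lam lam' ‖p.2‖)
    (hunit : ‖Ψ (lam ‖p.2‖) p‖ = 1) {S K ℓ : ℝ} (hS0 : 0 ≤ S)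
    (hS : ‖fderiv ℝ (uncurry Ψ) (lam ‖p.2‖, p) (1, 0)‖ ≤ S)
    (hK : ∀ w : F, ‖p.2‖ * ‖fderiv ℝ (uncurry Ψ) (lam ‖p.2‖, p) (0, ((0 : E), w))‖ ≤ K * ‖w‖)
    (hℓ : ‖p.2‖ * |lam'| ≤ ℓ) (w : F) :
    ‖fderiv ℝ (radialFamilyMap ρ Ψ lam) p (0, w)‖ ≤ ρ * (ℓ * S + K + 1) * ‖w‖ := by
  set t : ℝ := ‖p.2‖ with ht
  have ht0 : 0 < t := norm_pos_iff.2 hp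
  set L := fderiv ℝ (uncurry Ψ) (lam ‖p.2‖, p) with hL
  set a : ℝ := ⟪‖p.2‖⁻¹ • p.2, w⟫ with ha
  have hab : |a| ≤ ‖w‖ := abs_inner_unit_le w
  rw [(hasFDerivAt_radialFamilyMap hp hΨ hlam).fderiv]
  -- evaluate the derivative at `(0, w)`
  have heval : ((ρ * ‖p.2‖) • L.comp ((lam' • (innerSL ℝ (‖p.2‖⁻¹ • p.2)).comp (ContinuousLinearMap.snd ℝ E F)).prod
        (ContinuousLinearMap.id ℝ (E × F))) +
      ((ρ : ℝ) • (innerSL ℝ (‖p.2‖⁻¹ • p.2)).comp (ContinuousLinearMap.snd ℝ E F)).smulRight (Ψ (lam ‖p.2‖) p))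
        ((0 : E), w) = (ρ * t) • L (lam' * a, ((0 : E), w)) + (ρ * a) • Ψ (lam ‖p.2‖) p := by
    change (ρ * ‖p.2‖) • L (lam' • ⟪‖p.2‖⁻¹ • p.2, w⟫, ((0 : E), w)) + (ρ • ⟪‖p.2‖⁻¹ • p.2, w⟫) • Ψ (lam ‖p.2‖) p = _
    rw [← ha, ← ht, smul_eq_mul, smul_eq_mul]
  rw [heval]
  -- split `L (λ' a, (0, w)) = (λ' a) • L (1, 0) + L (0, (0, w))`
  have hsplit : L (lam' * a, ((0 : E), w)) = (lam' * a) • L (1, 0) + L (0, ((0 : E), w)) := by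
    have e : ((lam' * a, ((0 : E), w)) : ℝ × (E × F)) = (lam' * a) • ((1 : ℝ), (0 : E × F)) + (0, ((0 : E), w)) := by
      ext <;> simp
    rw [e, map_add, map_smul]
  rw [hsplit]
  have h1 : ‖(ρ * t) • ((lam' * a) • L (1, 0) + L (0, ((0 : E), w)))‖ ≤ ρ * (ℓ * S + K) * ‖w‖ := by
    rw [norm_smul, Real.norm_eq_abs, abs_of_nonneg (by positivity)]
    have h2 : ‖(lam' * a) • L (1, 0) + L (0, ((0 : E), w))‖ ≤ |lam'| * ‖w‖ * S + ‖L (0, ((0 : E), w))‖ := by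
      refine (norm_add_le _ _).trans (add_le_add ?_ le_rfl)
      rw [norm_smul, Real.norm_eq_abs, abs_mul]
      exact mul_le_mul (mul_le_mul_of_nonneg_left hab (abs_nonneg _)) hS (norm_nonneg _) (by positivity)
    calc ρ * t * ‖(lam' * a) • L (1, 0) + L (0, ((0 : E), w))‖ ≤ ρ * t * (|lam'| * ‖w‖ * S + ‖L (0, ((0 : E), w))‖) :=
          mul_le_mul_of_nonneg_left h2 (by positivity)
      _ = ρ * ((t * |lam'|) * ‖w‖ * S + t * ‖L (0, ((0 : E), w))‖) := by ring
      _ ≤ ρ * (ℓ * ‖w‖ * S + K * ‖w‖) := by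
          apply mul_le_mul_of_nonneg_left _ hρ
          exact add_le_add (mul_le_mul_of_nonneg_right (mul_le_mul_of_nonneg_right hℓ (norm_nonneg _)) hS0) (hK w)
      _ = ρ * (ℓ * S + K) * ‖w‖ := by ring
  have h3 : ‖(ρ * a) • Ψ (lam ‖p.2‖) p‖ ≤ ρ * ‖w‖ := by
    rw [norm_smul, hunit, mul_one, Real.norm_eq_abs, abs_mul, abs_of_nonneg hρ]
    exact mul_le_mul_of_nonneg_left hab hρ
  calc _ ≤ ρ * (ℓ * S + K) * ‖w‖ + ρ * ‖w‖ := (norm_add_le _ _).trans (add_le_add h1 h3)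
    _ = ρ * (ℓ * S + K + 1) * ‖w‖ := by ring

end Radial

/-! ### Cone zone -/

section Cone

variable {N : E × F → F} {μ : ℝ → ℝ} {p : E × F}

omit [NormedAddCommGroup E] [NormedSpace ℝ E] in
/-- **(E5/E6, cone zone)** `‖coneifyMap N μ p‖ = (‖y‖ / μ ‖y‖) ‖N (coneifyPoint μ p)‖` for
`μ ‖y‖ > 0`. [folklore] -/
theorem norm_coneifyMap (hμ0 : 0 < μ ‖p.2‖) : ‖coneifyMap N μ p‖ = ‖p.2‖ / μ ‖p.2‖ * ‖N (coneifyPoint μ p)‖ := by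
  rw [coneifyMap, norm_smul, Real.norm_eq_abs, abs_of_nonneg (div_nonneg (norm_nonneg _) hμ0.le)]
  rfl

/-- **(E4, cone zone)** `‖D_yφ w‖ ≤ (X₄ + K₀ d / μ) ‖w‖`, where `X₄` bounds the fibre derivative of
`N` at the cone point, `d` its target Euler defect there and `|1 − ‖y‖ μ'/μ| ≤ K₀`. [folklore] -/
theorem norm_fderiv_coneifyMap_inr_le (hp : p.2 ≠ 0) (hN : ContDiffAt ℝ ∞ N (coneifyPoint μ p))
    (hμ : ContDiffAt ℝ ∞ μ ‖p.2‖) (hμ0 : 0 < μ ‖p.2‖) {X₄ K₀ d : ℝ} (hK₀ : 0 ≤ K₀)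
    (hX₄ : ∀ w : F, ‖fderiv ℝ N (coneifyPoint μ p) (0, w)‖ ≤ X₄ * ‖w‖)
    (hd : ‖fderiv ℝ N (coneifyPoint μ p) (0, (coneifyPoint μ p).2) - N (coneifyPoint μ p)‖ ≤ d)
    (hκ : |1 - ‖p.2‖ * deriv μ ‖p.2‖ / μ ‖p.2‖| ≤ K₀) (w : F) :
    ‖fderiv ℝ (coneifyMap N μ) p (0, w)‖ ≤ (X₄ + K₀ * d / μ ‖p.2‖) * ‖w‖ := by
  rw [fderiv_coneifyMap_apply_inr hp hN hμ hμ0.ne' w]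
  have hab : |⟪‖p.2‖⁻¹ • p.2, w⟫| ≤ ‖w‖ := abs_inner_unit_le w
  have hd0 : 0 ≤ d := (norm_nonneg _).trans hd
  refine (norm_sub_le _ _).trans ?_
  rw [add_mul]
  refine add_le_add (hX₄ w) ?_
  rw [norm_smul, Real.norm_eq_abs, abs_div, abs_mul, abs_of_pos hμ0]
  calc |⟪‖p.2‖⁻¹ • p.2, w⟫| * |1 - ‖p.2‖ * deriv μ ‖p.2‖ / μ ‖p.2‖| / μ ‖p.2‖ *
        ‖fderiv ℝ N (coneifyPoint μ p) (0, (coneifyPoint μ p).2) - N (coneifyPoint μ p)‖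
      ≤ ‖w‖ * K₀ / μ ‖p.2‖ * d := by
        apply mul_le_mul _ hd (norm_nonneg _) (by positivity)
        exact div_le_div_of_nonneg_right (mul_le_mul hab hκ (abs_nonneg _) (norm_nonneg _)) hμ0.le
    _ = K₀ * d / μ ‖p.2‖ * ‖w‖ := by ring

end Cone

/-! ### Rounding zone -/

section Round

variable {N : E × F → F} {r₁ ρ : ℝ} {η : ℝ → ℝ} {p : E × F}

omit [NormedAddCommGroup E] [NormedSpace ℝ E] in
/-- **(E5, rounding zone)** `ρ ‖y‖ ≤ ‖roundMap N r₁ ρ η p‖` when `0 < ρ ≤ ‖V‖`, `η ∈ [0, 1]`.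
[folklore] -/
theorem norm_roundMap_ge (hV : linkField N r₁ p ≠ 0) (hρ : 0 < ρ) (hρV : ρ ≤ ‖linkField N r₁ p‖)
    (hη01 : η ‖p.2‖ ∈ Icc (0 : ℝ) 1) : ρ * ‖p.2‖ ≤ ‖roundMap N r₁ ρ η p‖ := by
  have hβ : 0 < ‖linkField N r₁ p‖ := norm_pos_iff.2 hV
  have hc : 0 ≤ (1 - η ‖p.2‖) * ρ / ‖linkField N r₁ p‖ + η ‖p.2‖ :=
    add_nonneg (div_nonneg (mul_nonneg (by linarith [hη01.2]) hρ.le) hβ.le) hη01.1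
  rw [norm_roundMap hV hc]
  have : ρ ≤ (1 - η ‖p.2‖) * ρ + η ‖p.2‖ * ‖linkField N r₁ p‖ := by nlinarith [hη01.1, hη01.2]
  calc ρ * ‖p.2‖ = ‖p.2‖ * ρ := mul_comm _ _
    _ ≤ ‖p.2‖ * ((1 - η ‖p.2‖) * ρ + η ‖p.2‖ * ‖linkField N r₁ p‖) := mul_le_mul_of_nonneg_left this (norm_nonneg _)

omit [NormedAddCommGroup E] [NormedSpace ℝ E] in
/-- **(E6, rounding zone)** `‖roundMap N r₁ ρ η p‖ ≤ ‖V‖ ‖y‖` when `0 < ρ ≤ ‖V‖`, `η ∈ [0, 1]`.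
[folklore] -/
theorem norm_roundMap_le (hV : linkField N r₁ p ≠ 0) (hρ : 0 < ρ) (hρV : ρ ≤ ‖linkField N r₁ p‖)
    (hη01 : η ‖p.2‖ ∈ Icc (0 : ℝ) 1) : ‖roundMap N r₁ ρ η p‖ ≤ ‖linkField N r₁ p‖ * ‖p.2‖ := by
  have hβ : 0 < ‖linkField N r₁ p‖ := norm_pos_iff.2 hV
  have hc : 0 ≤ (1 - η ‖p.2‖) * ρ / ‖linkField N r₁ p‖ + η ‖p.2‖ :=
    add_nonneg (div_nonneg (mul_nonneg (by linarith [hη01.2]) hρ.le) hβ.le) hη01.1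
  rw [norm_roundMap hV hc]
  have : (1 - η ‖p.2‖) * ρ + η ‖p.2‖ * ‖linkField N r₁ p‖ ≤ ‖linkField N r₁ p‖ := by nlinarith [hη01.1, hη01.2]
  calc ‖p.2‖ * ((1 - η ‖p.2‖) * ρ + η ‖p.2‖ * ‖linkField N r₁ p‖) ≤ ‖p.2‖ * ‖linkField N r₁ p‖ :=
        mul_le_mul_of_nonneg_left this (norm_nonneg _)
    _ = ‖linkField N r₁ p‖ * ‖p.2‖ := mul_comm _ _

/-- The fibre derivative of the link field is bounded: `‖D_y V (0, w)‖ ≤ 2 X₄ ‖w‖ / ‖y‖` when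
`‖D N (q₁) (0, z)‖ ≤ X₄ ‖z‖` at the link point. [folklore] -/
theorem norm_fderiv_linkField_inr_le (hp : p.2 ≠ 0) (hr : r₁ ≠ 0) (hN : ContDiffAt ℝ ∞ N (linkPoint r₁ p))
    {X₄ : ℝ} (hX0 : 0 ≤ X₄) (hX₄ : ∀ z : F, ‖fderiv ℝ N (linkPoint r₁ p) (0, z)‖ ≤ X₄ * ‖z‖) (w : F) :
    ‖fderiv ℝ (linkField N r₁) p (0, w)‖ ≤ 2 * X₄ * ‖w‖ / ‖p.2‖ := by
  have ht0 : 0 < ‖p.2‖ := norm_pos_iff.2 hp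
  rw [fderiv_linkField_apply_inr hp hr hN w, norm_smul, norm_inv, norm_norm]
  have hperp : ‖w - ⟪‖p.2‖⁻¹ • p.2, w⟫ • (‖p.2‖⁻¹ • p.2)‖ ≤ 2 * ‖w‖ := by
    refine (norm_sub_le _ _).trans ?_
    rw [two_mul]
    refine add_le_add le_rfl ?_
    rw [norm_smul, Real.norm_eq_abs, norm_smul, norm_inv, norm_norm, inv_mul_cancel₀ ht0.ne', mul_one]
    exact abs_inner_unit_le w
  calc ‖p.2‖⁻¹ * ‖fderiv ℝ N (linkPoint r₁ p) (0, w - ⟪‖p.2‖⁻¹ • p.2, w⟫ • (‖p.2‖⁻¹ • p.2))‖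
      ≤ ‖p.2‖⁻¹ * (X₄ * (2 * ‖w‖)) := by
        apply mul_le_mul_of_nonneg_left _ (inv_nonneg.2 ht0.le)
        exact (hX₄ _).trans (mul_le_mul_of_nonneg_left hperp hX0)
    _ = 2 * X₄ * ‖w‖ / ‖p.2‖ := by field_simp

/-- **(E4, rounding zone)** `‖D_yφ w‖ ≤ (3 ‖V‖ + C_η ‖V‖ + 6 X₄) ‖w‖` for
`φ = roundMap N r₁ ρ η`, given `0 < ρ ≤ ‖V‖`, `η ∈ [0, 1]`, `‖y‖ |η'| ≤ C_η` and the fibre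
derivative bound `X₄` of `N` at the link point. [folklore] -/
theorem norm_fderiv_roundMap_inr_le (hp : p.2 ≠ 0) (hr : r₁ ≠ 0) (hN : ContDiffAt ℝ ∞ N (linkPoint r₁ p))
    (hV : linkField N r₁ p ≠ 0) (hη : ContDiffAt ℝ ∞ η ‖p.2‖) (hη01 : η ‖p.2‖ ∈ Icc (0 : ℝ) 1)
    (hρ : 0 < ρ) (hρV : ρ ≤ ‖linkField N r₁ p‖) {X₄ Cη : ℝ} (hX0 : 0 ≤ X₄)
    (hX₄ : ∀ z : F, ‖fderiv ℝ N (linkPoint r₁ p) (0, z)‖ ≤ X₄ * ‖z‖)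
    (hCη : ‖p.2‖ * |deriv η ‖p.2‖| ≤ Cη) (w : F) :
    ‖fderiv ℝ (roundMap N r₁ ρ η) p (0, w)‖ ≤
      (3 * ‖linkField N r₁ p‖ + Cη * ‖linkField N r₁ p‖ + 6 * X₄) * ‖w‖ := by
  rw [fderiv_roundMap_apply_inr hp hN hV hη w]
  -- notation
  set t : ℝ := ‖p.2‖ with ht
  have ht0 : 0 < t := norm_pos_iff.2 hp
  set a : ℝ := ⟪‖p.2‖⁻¹ • p.2, w⟫ with ha
  set V₀ : F := linkField N r₁ p with hV₀
  set β : ℝ := ‖V₀‖ with hβ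
  have hβ0 : 0 < β := norm_pos_iff.2 hV
  set U : F := fderiv ℝ (linkField N r₁) p (0, w) with hU
  set e : ℝ := η t with he
  set e' : ℝ := deriv η t with he'
  have hab : |a| ≤ ‖w‖ := abs_inner_unit_le w
  have hU' : ‖U‖ ≤ 2 * X₄ * ‖w‖ / t := norm_fderiv_linkField_inr_le hp hr hN hX0 hX₄ w
  have htU : t * ‖U‖ ≤ 2 * X₄ * ‖w‖ := by
    rw [← le_div_iff₀' ht0]; exact hU'
  -- the scalar `c = (1 − e) ρ / β + e ∈ [0, 2]`
  have hc0 : 0 ≤ (1 - e) * ρ / β + e := add_nonneg (div_nonneg (mul_nonneg (by linarith [hη01.2]) hρ.le) hβ0.le) hη01.1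
  have hρβ : ρ / β ≤ 1 := (div_le_one hβ0).2 hρV
  have hc2 : (1 - e) * ρ / β + e ≤ 2 := by
    have : (1 - e) * ρ / β ≤ 1 := by
      rw [div_le_one hβ0]; nlinarith [hη01.1, hη01.2]
    linarith [hη01.2]
  -- the inner product term `|⟪V̂, U⟫| ≤ ‖U‖`
  have hVU : |⟪‖V₀‖⁻¹ • V₀, U⟫| ≤ ‖U‖ := abs_inner_unit_le U
  -- first summand: the coefficient times `V₀`
  have hcoef : |a * ((1 - e) * ρ / β + e) +
      t * (e' * a * (1 - ρ / β) - (1 - e) * ρ * ⟪‖V₀‖⁻¹ • V₀, U⟫ / β ^ 2)| ≤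
      2 * ‖w‖ + Cη * ‖w‖ + 2 * X₄ * ‖w‖ / β := by
    have h1 : |a * ((1 - e) * ρ / β + e)| ≤ 2 * ‖w‖ := by
      rw [abs_mul, abs_of_nonneg hc0]
      calc |a| * ((1 - e) * ρ / β + e) ≤ ‖w‖ * 2 := mul_le_mul hab hc2 hc0 (norm_nonneg _)
        _ = 2 * ‖w‖ := mul_comm _ _
    have h2 : |t * (e' * a * (1 - ρ / β))| ≤ Cη * ‖w‖ := by
      rw [abs_mul, abs_of_pos ht0, abs_mul, abs_mul]
      have h01 : |1 - ρ / β| ≤ 1 := by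
        rw [abs_le]; constructor <;> nlinarith [div_nonneg hρ.le hβ0.le]
      calc t * (|e'| * |a| * |1 - ρ / β|) ≤ t * (|e'| * ‖w‖ * 1) := by
            apply mul_le_mul_of_nonneg_left _ ht0.le
            exact mul_le_mul (mul_le_mul_of_nonneg_left hab (abs_nonneg _)) h01 (abs_nonneg _) (by positivity)
        _ = (t * |e'|) * ‖w‖ := by ring
        _ ≤ Cη * ‖w‖ := mul_le_mul_of_nonneg_right hCη (norm_nonneg _)
    have h3 : |t * ((1 - e) * ρ * ⟪‖V₀‖⁻¹ • V₀, U⟫ / β ^ 2)| ≤ 2 * X₄ * ‖w‖ / β := by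
      rw [abs_mul, abs_of_pos ht0, abs_div, abs_mul, abs_mul, abs_of_nonneg (by linarith [hη01.2] : (0:ℝ) ≤ 1 - e),
        abs_of_pos hρ, abs_of_pos (by positivity : (0:ℝ) < β ^ 2)]
      calc t * ((1 - e) * ρ * |⟪‖V₀‖⁻¹ • V₀, U⟫| / β ^ 2) ≤ t * (1 * β * ‖U‖ / β ^ 2) := by
            apply mul_le_mul_of_nonneg_left _ ht0.le
            apply div_le_div_of_nonneg_right _ (by positivity)
            exact mul_le_mul (mul_le_mul (by linarith [hη01.1]) hρV (hρ.le) zero_le_one) hVU (abs_nonneg _)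
              (by positivity)
        _ = (t * ‖U‖) / β := by field_simp
        _ ≤ 2 * X₄ * ‖w‖ / β := div_le_div_of_nonneg_right htU hβ0.le
    have e1 : a * ((1 - e) * ρ / β + e) + t * (e' * a * (1 - ρ / β) - (1 - e) * ρ * ⟪‖V₀‖⁻¹ • V₀, U⟫ / β ^ 2) =
        a * ((1 - e) * ρ / β + e) + t * (e' * a * (1 - ρ / β)) - t * ((1 - e) * ρ * ⟪‖V₀‖⁻¹ • V₀, U⟫ / β ^ 2) := by
      ring
    rw [e1]
    calc _ ≤ |a * ((1 - e) * ρ / β + e) + t * (e' * a * (1 - ρ / β))| +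
          |t * ((1 - e) * ρ * ⟪‖V₀‖⁻¹ • V₀, U⟫ / β ^ 2)| := abs_sub _ _
      _ ≤ (|a * ((1 - e) * ρ / β + e)| + |t * (e' * a * (1 - ρ / β))|) +
          |t * ((1 - e) * ρ * ⟪‖V₀‖⁻¹ • V₀, U⟫ / β ^ 2)| := add_le_add (abs_add_le _ _) le_rfl
      _ ≤ 2 * ‖w‖ + Cη * ‖w‖ + 2 * X₄ * ‖w‖ / β := add_le_add (add_le_add h1 h2) h3
  have hfirst : ‖(a * ((1 - e) * ρ / β + e) +
      t * (e' * a * (1 - ρ / β) - (1 - e) * ρ * ⟪‖V₀‖⁻¹ • V₀, U⟫ / β ^ 2)) • V₀‖ ≤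
      (2 * ‖w‖ + Cη * ‖w‖) * β + 2 * X₄ * ‖w‖ := by
    rw [norm_smul, Real.norm_eq_abs]
    calc _ ≤ (2 * ‖w‖ + Cη * ‖w‖ + 2 * X₄ * ‖w‖ / β) * β := mul_le_mul_of_nonneg_right hcoef hβ0.le
      _ = (2 * ‖w‖ + Cη * ‖w‖) * β + 2 * X₄ * ‖w‖ := by field_simp
  have hsecond : ‖(t * ((1 - e) * ρ / β + e)) • U‖ ≤ 4 * X₄ * ‖w‖ := by
    rw [norm_smul, Real.norm_eq_abs, abs_mul, abs_of_pos ht0, abs_of_nonneg hc0]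
    calc t * ((1 - e) * ρ / β + e) * ‖U‖ = ((1 - e) * ρ / β + e) * (t * ‖U‖) := by ring
      _ ≤ 2 * (2 * X₄ * ‖w‖) := mul_le_mul hc2 htU (by positivity) (by norm_num)
      _ = 4 * X₄ * ‖w‖ := by ring
  calc _ ≤ (2 * ‖w‖ + Cη * ‖w‖) * β + 2 * X₄ * ‖w‖ + 4 * X₄ * ‖w‖ :=
        (norm_add_le _ _).trans (add_le_add hfirst hsecond)
    _ = (2 * β + Cη * β + 6 * X₄) * ‖w‖ := by ring
    _ ≤ (3 * β + Cη * β + 6 * X₄) * ‖w‖ := by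
        apply mul_le_mul_of_nonneg_right _ (norm_nonneg _)
        linarith [hβ0.le]

end Round

end Literature.Topology.FourManifolds
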